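import Mathlib
import HarnessLib
import Literature.Probability.MarkovChains.MetropolisHastings

/-!
# Heat bath on the classes of a partition — and the Cabibbo–Marinari subgroup hit

HONEST FRAMING: exact (Metropolis-corrected) sampling algorithms for lattice gauge theory;
figures of merit are autocorrelation/cost numbers at stated couplings and volumes; no
continuum-physics claim.

Venture `LatticeQCDFlow` (cell pub-lqcd), topic `Exactness`; FANOUT row 9 (`eng-latcore`, the
`latflow.core` engine: `updates.sweep(f, beta, 'hb', rng)` = Cabibbo–Marinari SU(2)-SUBGROUP heat
bath, Kennedy–Pendleton / Creutz sampling of the subgroup element).  NEW WORK of the cell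
(elementary finite sums); the printed names appear in docstrings only, nothing is cited as a fact.

## Content

The most general "heat bath" resamples the state INSIDE ITS CLASS of a fixed partition of the
state space, from the target weight restricted to that class.  With `c : X → C` the class map,
`Z k = ∑_{y : c y = k} w y`:

* `partitionHeatBath w c x y = [c y = c x] · w y / Z (c x)`;
* `partitionHeatBath_detailedBalance` — detailed balance with `w`, with NO hypothesis (inside a
  class both sides are `w x w y / Z`, across classes both vanish);
* `partitionHeatBath_sum_eq_one` / `_isStationary` (when the class normalisers are non-zero, e.g.
  `w > 0`: `classZ_pos`), `partitionHeatBath_nonneg`;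
* the block heat bath of a product `X × Y` ("resample `x`, keep `y`") is the partition by the second
  coordinate; the CABIBBO–MARINARI hit "`U ↦ A U` with `A` drawn from the subgroup `H` with density
  `∝ w (A U)`" is the partition of the group `G` into RIGHT COSETS `H g`:
  `subgroupHeatBath H w = partitionHeatBath w (right-coset class)`, `subgroupHeatBath_detailedBalance`,
  and `subgroupHeatBath_eq_zero` — the kernel only connects `g` to points `g'` with `g' g⁻¹ ∈ H`.

Dictionary: `G` = (a finite stand-in for) `SU(N)` at one link with the other links frozen, `w U =
exp((β/N) Re tr (U S†)) ×` (weight of the frozen rest), `H` = one embedded `SU(2)`; a CM sweep = a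
sequential scan over links and subgroups of such kernels (`SequentialScanAdjoint.lean`), each in
detailed balance by this file whatever the subgroup and whatever the weight — the sampling recipe for
`A` (Kennedy–Pendleton / Creutz, acceptance test A3 of the engine) only has to realise the
conditional density, which is the analytic part not modelled here.
-/

namespace Summit.Ventures.LatticeQCDFlow.Exactness

open Finset
open Literature.Probability.MarkovChains

section Partition

variable {X C : Type*} [Fintype X] [DecidableEq C]

/-- Normaliser of the class `k`: the total weight of the states mapped to `k`. -/
noncomputable def classZ (w : X → ℝ) (c : X → C) (k : C) : ℝ := ∑ y, if c y = k then w y else 0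

/-- Heat bath on the classes of the partition `c`: resample inside the current class from the
restricted weight. -/
noncomputable def partitionHeatBath (w : X → ℝ) (c : X → C) (x y : X) : ℝ :=
  if c y = c x then w y / classZ w c (c x) else 0

/-- Across classes the kernel vanishes. -/
theorem partitionHeatBath_of_ne {w : X → ℝ} {c : X → C} {x y : X} (h : c y ≠ c x) :
    partitionHeatBath w c x y = 0 := by
  simp [partitionHeatBath, h]

/-- Inside a class the kernel is the restricted, normalised weight of the target point. -/
theorem partitionHeatBath_of_eq {w : X → ℝ} {c : X → C} {x y : X} (h : c y = c x) :
    partitionHeatBath w c x y = w y / classZ w c (c x) := by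
  simp [partitionHeatBath, h]

/-- **Detailed balance of the class heat bath** with respect to `w` — unconditionally. -/
theorem partitionHeatBath_detailedBalance (w : X → ℝ) (c : X → C) :
    DetailedBalance w (partitionHeatBath w c) := by
  intro x y
  by_cases h : c y = c x
  · rw [partitionHeatBath_of_eq h, partitionHeatBath_of_eq h.symm, h]
    ring
  · rw [partitionHeatBath_of_ne h, partitionHeatBath_of_ne (Ne.symm h), mul_zero, mul_zero]

/-- Row sums are one when the normaliser of the current class is non-zero. -/
theorem partitionHeatBath_sum_eq_one {w : X → ℝ} {c : X → C} {x : X} (hZ : classZ w c (c x) ≠ 0) :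
    ∑ y, partitionHeatBath w c x y = 1 := by
  have h : ∀ y, partitionHeatBath w c x y = (if c y = c x then w y else 0) / classZ w c (c x) := by
    intro y
    by_cases hy : c y = c x
    · simp [partitionHeatBath, hy]
    · simp [partitionHeatBath, hy]
  simp_rw [h, ← sum_div]
  exact div_self hZ

/-- Entrywise non-negativity for a non-negative weight. -/
theorem partitionHeatBath_nonneg {w : X → ℝ} (hw : ∀ x, 0 ≤ w x) (c : X → C) (x y : X) :
    0 ≤ partitionHeatBath w c x y := by
  unfold partitionHeatBath classZ
  split_ifs
  · exact div_nonneg (hw y) (sum_nonneg fun z _ => by split_ifs <;> simp [hw])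
  · exact le_rfl

/-- The class heat bath leaves `w` stationary when every visited class has a non-zero normaliser. -/
theorem partitionHeatBath_isStationary {w : X → ℝ} {c : X → C} (hZ : ∀ x, classZ w c (c x) ≠ 0) :
    IsStationary w (partitionHeatBath w c) :=
  (partitionHeatBath_detailedBalance w c).isStationary fun x => partitionHeatBath_sum_eq_one (hZ x)

/-- A strictly positive weight gives every occupied class a positive normaliser. -/
theorem classZ_pos {w : X → ℝ} (hw : ∀ x, 0 < w x) (c : X → C) (x : X) : 0 < classZ w c (c x) := by
  unfold classZ
  have hle : ∀ y ∈ (univ : Finset X), 0 ≤ (if c y = c x then w y else 0) :=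
    fun y _ => by split_ifs <;> simp [le_of_lt (hw y)]
  have hx : (0 : ℝ) < (if c x = c x then w x else 0) := by simp [hw x]
  exact lt_of_lt_of_le hx (single_le_sum hle (mem_univ x))

/-- **The product block heat bath is a class heat bath**: partition `X × Y` by the frozen second
coordinate. -/
theorem partitionHeatBath_snd {A B : Type*} [Fintype A] [Fintype B] [DecidableEq B]
    (π : A × B → ℝ) (a a' : A) (b : B) :
    partitionHeatBath π Prod.snd (a, b) (a', b) = π (a', b) / ∑ x, π (x, b) := by
  rw [partitionHeatBath_of_eq (show Prod.snd (a', b) = Prod.snd (a, b) from rfl)]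
  congr 1
  unfold classZ
  rw [Fintype.sum_prod_type]
  simp only
  rw [Finset.sum_comm, Finset.sum_eq_single b]
  · simp
  · intro b' _ hb'
    simp [hb']
  · intro hb
    exact absurd (mem_univ b) hb

end Partition

section Subgroup

variable {G : Type*} [Group G] (H : Subgroup G)

/-- The right-coset class map `g ↦ H g` (as a point of the quotient by `QuotientGroup.rightRel H`). -/
def rightCoset (g : G) : Quotient (QuotientGroup.rightRel H) := Quotient.mk _ g

/-- Two points have the same right coset iff they differ by a subgroup element on the left. -/
theorem rightCoset_eq_iff (g g' : G) : rightCoset H g' = rightCoset H g ↔ g' * g⁻¹ ∈ H := by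
  unfold rightCoset
  rw [Quotient.eq, QuotientGroup.rightRel_apply]
  constructor
  · intro h
    simpa using H.inv_mem h
  · intro h
    simpa using H.inv_mem h

/-- **The Cabibbo–Marinari subgroup hit** as a kernel on the (finite stand-in for the) link group:
resample inside the right coset `H g` from the restricted weight — `g ↦ a g`, `a ∈ H` drawn with
density `∝ w (a g)`. -/
noncomputable def subgroupHeatBath [Fintype G] (w : G → ℝ) : G → G → ℝ := by
  classical
  exact partitionHeatBath w (rightCoset H)

/-- **Detailed balance of the subgroup hit**, for every weight and every subgroup. -/
theorem subgroupHeatBath_detailedBalance [Fintype G] (w : G → ℝ) : DetailedBalance w (subgroupHeatBath H w) := by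
  classical
  unfold subgroupHeatBath
  exact partitionHeatBath_detailedBalance w _

/-- The subgroup hit only connects `g` to points of its right coset: `g' g⁻¹ ∉ H ⇒` zero rate. -/
theorem subgroupHeatBath_eq_zero [Fintype G] (w : G → ℝ) {g g' : G} (h : g' * g⁻¹ ∉ H) :
    subgroupHeatBath H w g g' = 0 := by
  classical
  unfold subgroupHeatBath
  exact partitionHeatBath_of_ne (mt (rightCoset_eq_iff H g g').mp h)

/-- The subgroup hit is `w`-stationary for a strictly positive weight. -/
theorem subgroupHeatBath_isStationary [Fintype G] {w : G → ℝ} (hw : ∀ g, 0 < w g) :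
    IsStationary w (subgroupHeatBath H w) := by
  classical
  unfold subgroupHeatBath
  exact partitionHeatBath_isStationary fun g => (classZ_pos hw _ g).ne'

end Subgroup

end Summit.Ventures.LatticeQCDFlow.Exactness
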